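import Summits.ValiantsHypothesis.ValiantsHypothesis.Theorems.LacunarySymmetroidMatrixDescartesDoorA26WallBubblingDoublyConfluentFrame

/-!
# Wall bubbling for `DoorA26` — TWO WEYL PAIRS: THE DOUBLY-CONFLUENT LIMIT OF A CLUSTER (Gram normalisation, realisable limit frame)

LINE / STUBS.  Crux `Theses.LacunarySymmetroid.DoorA26` (stmt-ValiantsHypothesis-19979; OPEN, typed, never asserted), line
`Cruxes/DoorA26/Lines/wall_bubbling.lean` (val-idea-15), obligation (W) `Stmt.stub_weylFaces`; statement file
`Cruxes/DoorA26/Lines/wall_bubbling_ConfluentDoor.lean` rev 4: the two-Weyl-pair strata of `Stmt.weylFaces_deepVal` / `Stmt.weylFaces_wall`.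
Seat val-sym-door-p2 g13 (W1 #27).  This is W2's `…ConfluentLimit.confluentLimit` (door-p1 g14) with the TWO-DSLOPE frame of W1 #25
(`frame_det₂`, `doublyConfluentDet_eq_quadForm`):

* **`doublyConfluentLimit`** — for ANY sequence of genuine `(2,6)` pencils `t ↦ det Σ_l e^{δ^ν_l t}U^ν_l` (symmetric letters, each not identically
  zero) whose exponents converge to a point with TWO Weyl pairs at the positions `0,5` and `1,4` (`δ0 5 = δ0 0`, `δ0 4 = δ0 1`; NO hypothesis on
  the four values `δ0 0, δ0 1, δ0 2, δ0 3`): along a subsequence `φ`, after scalar normalisation `a_k`, the functions converge CONTINUOUSLY WITH ALL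
  DERIVATIVES along every further subsequence and every convergent sequence of times to the DOUBLY-CONFLUENT determinant
  `det(e^{δ₀t}(W₀ + tW₅) + e^{δ₁t}(W₁ + tW₄) + Σ_{k<2} e^{δ_{k+2}t}W_{k+2})` of a SYMMETRIC limit frame `W` with SOME NON-ZERO polar Gram entry.
  Mechanism: Gram-normalise the two-dslope frame (one compactness extraction, `levelSelection_multi` p658176), closedness of `Realisable`
  (`realisable_of_tendsto` p619386), the Leibniz bookkeeping of `…ConfluentFrame`.  No anatomy, no level selection by hand.

Whether the limit is NOT identically zero is a separate, stratum-dependent INERTIA statement (W1 #26 `…DoublyConfluentNondeg`: value-generic;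
the wall strata (c1)/(c2)/(c3) likewise) — at two pairs the slot functions `φ₀φ₄ = φ₅φ₁` coincide, and non-degeneracy is exactly the
non-realisability of the (D)-patterns of W1 #13.  With it and the COUNT W1 #24 (`≤ 19` with multiplicity, unconditionally) the window theorem at
two Weyl pairs is door-free (W1 #28).  No new definitions; nothing here bears on `DoorA26`, `MatrixDescartes` (stmt-ValiantsHypothesis-18050) or
`VP ≠ VNP`.  `--supports stmt-ValiantsHypothesis-19979 --as helper`.

[folklore] Newton form of Hermite interpolation; compactness; closed cones.  [this work] the two-pair frame bookkeeping.
-/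

-- `Summit.ValiantsHypothesis.ValiantsHypothesis.…` repeats a component by the D-0017 layout
-- (single-conjunct summit), which the `dupNamespace` linter flags; the name is mandated.
set_option linter.dupNamespace false

namespace Summit.ValiantsHypothesis.ValiantsHypothesis.Theorems.LacunarySymmetroidMatrixDescartes.WallBubbling

open Finset Filter Topology Polynomial
open Bubbling (polar Realisable polar_comm polar_self det_sum_smul_fin_two realisable_polarGram realisable_smul realisable_of_tendsto)
open scoped BigOperators

/-- **THE DOUBLY-CONFLUENT LIMIT OF A CLUSTER.**  See the module docstring.  Positions: pair A at `0, 5` (`δ^ν₀, δ^ν₅ → δ0 0 = δ0 5`), pair B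
at `1, 4` (`δ^ν₁, δ^ν₄ → δ0 1 = δ0 4`), ordinary letters at `2, 3` (as `k.succ.succ.castSucc.castSucc`, `k : Fin 2`).  Output: a subsequence `φ`,
scalars `a`, a SYMMETRIC limit frame `W` with some non-zero polar Gram entry, and CONTINUOUS CONVERGENCE WITH ALL DERIVATIVES of the normalised
genuine determinants to the doubly-confluent determinant of `W` along every further subsequence `ψ` and every convergent sequence of times.
[this work] -/
theorem doublyConfluentLimit (δs : ℕ → Fin 6 → ℝ) (δ0 : Fin 6 → ℝ)
    (hδ : ∀ l, Tendsto (fun ν => δs ν l) atTop (𝓝 (δ0 l))) (h50 : δ0 5 = δ0 0) (h41 : δ0 4 = δ0 1)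
    (U : ℕ → Fin 6 → Matrix (Fin 2) (Fin 2) ℝ) (hU : ∀ ν l, (U ν l).IsSymm)
    (hne : ∀ ν, ∃ t, (∑ l, Real.exp (δs ν l * t) • U ν l).det ≠ 0) :
    ∃ φ : ℕ → ℕ, StrictMono φ ∧
    ∃ (a : ℕ → ℝ) (W : Fin 6 → Matrix (Fin 2) (Fin 2) ℝ),
      (∀ l, (W l).IsSymm) ∧ (∃ p q, polar (W p) (W q) ≠ 0) ∧
      ∀ (n : ℕ) (ψ : ℕ → ℕ), StrictMono ψ → ∀ (ts : ℕ → ℝ) (t₀ : ℝ), Tendsto ts atTop (𝓝 t₀) →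
        Tendsto (fun k => iteratedDeriv n (fun t => a (ψ k) * (∑ l, Real.exp (δs (φ (ψ k)) l * t) • U (φ (ψ k)) l).det) (ts k))
          atTop (𝓝 (iteratedDeriv n
            (fun t => ((Real.exp (δ0 0 * t)) • (W 0 + t • W 5) + (Real.exp (δ0 1 * t)) • (W 1 + t • W 4)
              + ∑ k : Fin 2, (Real.exp (δ0 k.succ.succ.castSucc.castSucc * t)) • W k.succ.succ.castSucc.castSucc).det) t₀)) := by
  classical
  -- the two-dslope frames, their polar Gram entries and the Gram normalisation
  set V : ℕ → Fin 6 → Matrix (Fin 2) (Fin 2) ℝ := fun ν l =>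
    if l = 0 then U ν 0 + U ν 5 else if l = 1 then U ν 1 + U ν 4 else if l = 4 then (δs ν 4 - δs ν 1) • U ν 4
      else if l = 5 then (δs ν 5 - δs ν 0) • U ν 5 else U ν l with hV
  set M : ℕ → Fin 6 × Fin 6 → ℝ := fun ν pq => polar (V ν pq.1) (V ν pq.2) with hM
  set μ : ℕ → ℝ := fun ν => (univ : Finset (Fin 6 × Fin 6)).sup' (Finset.univ_nonempty) (fun pq => |M ν pq|) with hμ
  have hdom : ∀ ν pq, |M ν pq| ≤ μ ν := fun ν pq => Finset.le_sup' (fun pq => |M ν pq|) (Finset.mem_univ pq)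
  have hatt : ∀ ν, ∃ pq, |M ν pq| = μ ν := by
    intro ν
    obtain ⟨pq, _, hpq⟩ := Finset.exists_mem_eq_sup' (Finset.univ_nonempty (α := Fin 6 × Fin 6)) (fun pq => |M ν pq|)
    exact ⟨pq, hpq.symm⟩
  -- the coefficient functions at stage ν and in the limit
  set c : ℕ → Fin 6 → ℝ → ℝ := fun ν p t =>
    if p = 5 then dslope (fun y : ℝ => Real.exp (y * t)) (δs ν 0) (δs ν 5)
      else if p = 4 then dslope (fun y : ℝ => Real.exp (y * t)) (δs ν 1) (δs ν 4) else Real.exp (δs ν p * t) with hc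
  set c₀ : Fin 6 → ℝ → ℝ := fun p t =>
    if p = 5 then dslope (fun y : ℝ => Real.exp (y * t)) (δ0 0) (δ0 0)
      else if p = 4 then dslope (fun y : ℝ => Real.exp (y * t)) (δ0 1) (δ0 1) else Real.exp (δ0 p * t) with hc₀
  -- the frame identity at stage ν
  have hframe : ∀ ν t, (∑ l, Real.exp (δs ν l * t) • U ν l).det = ∑ p, ∑ q, M ν (p, q) * (c ν p t * c ν q t) := by
    intro ν t
    rw [frame_det₂]
  have hμpos : ∀ ν, 0 < μ ν := by
    intro ν
    obtain ⟨t, ht⟩ := hne ν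
    rw [hframe ν t] at ht
    obtain ⟨p, _, hp⟩ := Finset.exists_ne_zero_of_sum_ne_zero ht
    obtain ⟨q, _, hq⟩ := Finset.exists_ne_zero_of_sum_ne_zero hp
    have hM0 : M ν (p, q) ≠ 0 := fun h => hq (by rw [h, zero_mul])
    exact lt_of_lt_of_le (abs_pos.mpr hM0) (hdom ν (p, q))
  -- one compactness extraction
  obtain ⟨φ, hφ, cl, hcl, -, hcl1⟩ := levelSelection_multi M μ hμpos hdom hatt
  -- the limit Gram matrix is realisable
  have hreal : Realisable (Matrix.of fun p q => cl (p, q)) := by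
    refine realisable_of_tendsto (Gseq := fun k => (μ (φ k))⁻¹ • Matrix.of fun p q => M (φ k) (p, q)) ?_ ?_
    · intro k
      exact realisable_smul _ (realisable_polarGram (V (φ k)) (fun l => frame_isSymm₂ (δs (φ k)) (U (φ k)) (hU (φ k)) l))
    · refine tendsto_pi_nhds.mpr fun p => tendsto_pi_nhds.mpr fun q => ?_
      have := hcl (p, q)
      simp only [Matrix.smul_apply, Matrix.of_apply, smul_eq_mul]
      simpa [div_eq_inv_mul] using this
  obtain ⟨ε, W, hε, hW, hGW⟩ := hreal
  have hε2 : ε * ε = 1 := by rcases hε with rfl | rfl <;> norm_num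
  -- limit entries in terms of the realising letters
  have hcW : ∀ p q, ε * cl (p, q) = polar (W p) (W q) := by
    intro p q
    have := hGW p q
    simp only [Matrix.of_apply] at this
    rw [this, ← mul_assoc, hε2, one_mul]
  -- some polar entry of `W` is non-zero
  have hWne : ∃ p q, polar (W p) (W q) ≠ 0 := by
    obtain ⟨⟨p, q⟩, hpq⟩ := hcl1
    refine ⟨p, q, ?_⟩
    rw [← hcW]
    intro h
    rcases mul_eq_zero.mp h with h1 | h1
    · rcases hε with rfl | rfl <;> norm_num at h1
    · rw [h1, abs_zero] at hpq; norm_num at hpq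
  refine ⟨φ, hφ, fun k => ε * (μ (φ k))⁻¹, W, hW, hWne, ?_⟩
  -- continuous convergence with all derivatives
  intro n ψ hψ ts t₀ hts
  have hφψ : Tendsto (fun k => φ (ψ k)) atTop atTop := hφ.tendsto_atTop.comp hψ.tendsto_atTop
  -- rewrite approximants and limit as quadratic forms
  have happrox : ∀ k, (fun t => ε * (μ (φ (ψ k)))⁻¹ * (∑ l, Real.exp (δs (φ (ψ k)) l * t) • U (φ (ψ k)) l).det)
      = fun t => ∑ p, ∑ q, (ε * (M (φ (ψ k)) (p, q) / μ (φ (ψ k)))) * (c (φ (ψ k)) p t * c (φ (ψ k)) q t) := by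
    intro k; funext t
    rw [hframe, Finset.mul_sum]
    refine Finset.sum_congr rfl fun p _ => ?_
    rw [Finset.mul_sum]
    refine Finset.sum_congr rfl fun q _ => ?_
    rw [div_eq_mul_inv]; ring
  have hlimit : (fun t => ((Real.exp (δ0 0 * t)) • (W 0 + t • W 5) + (Real.exp (δ0 1 * t)) • (W 1 + t • W 4)
        + ∑ k : Fin 2, (Real.exp (δ0 k.succ.succ.castSucc.castSucc * t)) • W k.succ.succ.castSucc.castSucc).det)
      = fun t => ∑ p, ∑ q, polar (W p) (W q) * (c₀ p t * c₀ q t) := by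
    funext t; exact doublyConfluentDet_eq_quadForm δ0 W t
  rw [hlimit]
  simp only [happrox]
  -- apply the Leibniz bookkeeping of `…ConfluentFrame`
  refine tendsto_iteratedDeriv_quadForm (ι := Fin 6)
    (fun k p q => ε * (M (φ (ψ k)) (p, q) / μ (φ (ψ k)))) (fun p q => polar (W p) (W q))
    (fun k p t => c (φ (ψ k)) p t) (fun p t => c₀ p t) ?_ ?_ ts t₀ ?_ ?_ n
  · intro k p m
    by_cases hp5 : p = 5
    · simp only [hc, hp5, if_true]; exact contDiff_dslope_exp _ _ m
    · by_cases hp4 : p = 4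
      · subst hp4
        simp only [hc, hp5, if_false, if_true]
        exact contDiff_dslope_exp _ _ m
      · simp only [hc, hp5, hp4, if_false]; exact contDiff_exp_const_mul' _ m
  · intro p m
    by_cases hp5 : p = 5
    · simp only [hc₀, hp5, if_true]; exact contDiff_dslope_exp _ _ m
    · by_cases hp4 : p = 4
      · subst hp4
        simp only [hc₀, hp5, if_false, if_true]
        exact contDiff_dslope_exp _ _ m
      · simp only [hc₀, hp5, hp4, if_false]; exact contDiff_exp_const_mul' _ m
  · intro p q
    rw [← hcW p q]
    exact ((hcl (p, q)).comp hψ.tendsto_atTop).const_mul ε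
  · intro p i
    by_cases hp5 : p = 5
    · simp only [hc, hc₀, hp5, if_true]
      exact tendsto_iteratedDeriv_dslope_exp i ((hδ 0).comp hφψ) (by rw [← h50]; exact (hδ 5).comp hφψ) hts
    · by_cases hp4 : p = 4
      · subst hp4
        simp only [hc, hc₀, hp5, if_false, if_true]
        exact tendsto_iteratedDeriv_dslope_exp i ((hδ 1).comp hφψ) (by rw [← h41]; exact (hδ 4).comp hφψ) hts
      · simp only [hc, hc₀, hp5, hp4, if_false]
        exact tendsto_iteratedDeriv_exp i ((hδ p).comp hφψ) hts

end Summit.ValiantsHypothesis.ValiantsHypothesis.Theorems.LacunarySymmetroidMatrixDescartes.WallBubbling
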